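import Literature.NumberTheory.GaloisRepresentations.GaschutzProfiniteGenerators
import Literature.NumberTheory.GaloisRepresentations.LocalGaloisHOneCardBound
import Literature.NumberTheory.GaloisRepresentations.LocalGaloisSolvable
import Literature.NumberTheory.GaloisRepresentations.LocalFieldFiniteExtension
import Literature.NumberTheory.GaloisRepresentations.LocalFieldPadicProofs
import Literature.AnabelianGeometry.AbsoluteAnabelian.ProfiniteTerminology
import Mathlib.Topology.Algebra.ClopenNhdofOne
import HarnessLib

/-!
# [AbsTopI] Thm 2.6 (ii) input / [NSW] Thm 7.5.10 (finite generation clause): the absolute Galois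
# group of a `p`-adic local field is topologically finitely generated — PROVED modulo Tate's
# local Euler–Poincaré characteristic (a tree theorem, Summits-side)

S. Mochizuki, *Topics in Absolute Anabelian Geometry I* (2012) [AbsTopI], proof of Thm 2.6 (ii),
p. 23 l. 11–13: "the topological finite generation of `Π` follows from that of `Δ` [cf. Proposition
2.2], together with that of `G` [cf. [NSW], Theorem 7.5.10]" — `G = G_k` the absolute Galois group
of an MLF `k`; Neukirch–Schmidt–Wingberg, *Cohomology of Number Fields*, Thm. 7.5.10 (Jannsen–
Wingberg: `G_k` is generated by `[k : ℚ_p] + 3` elements).  This is GAP-LEDGER row G-L4t4-2 of the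
abc-iut cell: the hypothesis `IsTopologicallyFinitelyGenerated (absoluteGaloisGroup K)` of
`FundamentalExtension.thm26ii_of_starCondition` (AbsTopIThm26iiStarProofs.lean) and of
`lemma114_ii_reduction_of_rank_of_tfg` (AbsAnabLemma114ReductionProofs.lean).

We PROVE the finite-generation clause — not by the Jannsen–Wingberg structure theorem but by an
independent elementary route (honest caveat: this is NOT the cited proof; it establishes OUR typed
predicate):

1. every continuous finite quotient of `Γ_k` is solvable (tree `isSolvable_quotient_of_isOpen`);
2. for every finite discrete `Γ_k`-module `M` killed by a prime, `#H¹(Γ_k, M) ≤ |M| ^ (c_k + 2)`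
   (tree `natCard_continuousCohomology_one_le_pow`: Tate's local Euler–Poincaré characteristic —
   the tree's named fact `localEulerPoincareCharacteristic k`, PROVED Summits-side as
   `localEulerPoincareCharacteristic_holds` and carried HERE as the hypothesis `hEP` because a
   Literature file may not import it — together with local duality in bidegree `(2,0)`);
3. hence (Gaschütz lifting along a chief series, tree `exists_fin_generators_of_natCard_hOne_le`)
   every continuous finite quotient of `Γ_k` is generated by `D := c_k + 4` elements;
4. a profinite group all of whose finite discrete quotients are `D`-generated is topologically
   generated by `D` elements (`isTopologicallyFinitelyGenerated_of_forall_quotient`, compactness of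
   `Γ^D` over the directed family of open normal subgroups).

Main results: `isTopologicallyFinitelyGenerated_absoluteGaloisGroup_of_localEPC` (valued form,
`hEP : localEulerPoincareCharacteristic F`) and the `ℚ_p`-binder form
`isTopologicallyFinitelyGenerated_absoluteGaloisGroup_padic_of_localEPC` (hypothesis: the EPC
fact for all char-`0` non-archimedean local fields in `Type`, which is exactly what the Summits-side
theorem supplies; the unconditional corollary is filed Summits-side).

HONEST FRAMING: classical local Galois cohomology; nothing here bears on [IUTchIII] Cor. 3.12 or
asserts anything about abc; typed ≠ proved for anything not named above.

## References

* S. Mochizuki, *Topics in Absolute Anabelian Geometry I: Generalities*, J. Math. Sci. Univ. Tokyo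
  19 (2012), Thm 2.6 (ii) and its proof p. 23. [MochizukiAbsTopI2012]
* J. Neukirch, A. Schmidt, K. Wingberg, *Cohomology of Number Fields*, 2nd ed. (2008), Thm. 7.5.10.
  [NeukirchSchmidtWingberg2008]
* W. Gaschütz, *Zu einem von B. H. und H. Neumann gestellten Problem*, Math. Nachr. 14 (1955).
  [Gaschutz1955]
-/

noncomputable section

open Function Field Topology

namespace Literature.AnabelianGeometry.AbsoluteAnabelian

open Literature.NumberTheory.GaloisRepresentations

/-! ### Profinite groups with uniformly finitely generated finite quotients -/

section Profinite

variable {Γ : Type} [Group Γ] [TopologicalSpace Γ] [IsTopologicalGroup Γ] [CompactSpace Γ]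
  [TotallyDisconnectedSpace Γ]

/-- **A profinite group all of whose finite (discrete) quotients are generated by `D` elements is
topologically generated by `D` elements.**  For an open normal `U` let `C_U ⊆ Γ^D` be the set of
`D`-tuples generating `Γ` modulo `U`; the `C_U` are closed (preimages from the discrete `(Γ/U)^D`),
nonempty, and directed (`C_{U ∩ V} ⊆ C_U ∩ C_V`), so by compactness of `Γ^D` they have a common
point `x`; the subgroup generated by `x` meets every coset `γ U` (`U` open normal), and open normal
subgroups form a neighbourhood basis of `1` (Mathlib `exist_openNormalSubgroup_sub_open_nhds_of_one`),
so it is dense. [cite: NeukirchSchmidtWingberg2008, Thm. 7.5.10 (proof, reduction to finite quotients)] -/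
theorem isTopologicallyFinitelyGenerated_of_forall_quotient {D : ℕ}
    (h : ∀ (U : Subgroup Γ), U.Normal → IsOpen (U : Set Γ) →
      ∃ x : Fin D → Γ, Subgroup.closure (Set.range x) ⊔ U = ⊤) :
    IsTopologicallyFinitelyGenerated Γ := by
  classical
  -- the directed family of closed nonempty sets `C_U`
  let S := {U : Subgroup Γ // U.Normal ∧ IsOpen (U : Set Γ)}
  let C : S → Set (Fin D → Γ) := fun U => {x | Subgroup.closure (Set.range x) ⊔ U.1 = ⊤}
  haveI : Nonempty S := ⟨⟨⊤, inferInstance, by rw [Subgroup.coe_top]; exact isOpen_univ⟩⟩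
  have hclosed : ∀ U : S, IsClosed (C U) := by
    intro U
    haveI : U.1.Normal := U.2.1
    haveI : DiscreteTopology (Γ ⧸ U.1) := QuotientGroup.discreteTopology U.2.2
    -- `C_U` is the preimage of a subset of the discrete space `(Γ ⧸ U)^D`
    let q : (Fin D → Γ) → (Fin D → Γ ⧸ U.1) := fun x i => QuotientGroup.mk (x i)
    have hq : Continuous q :=
      continuous_pi fun i => (QuotientGroup.continuous_mk (N := U.1)).comp (continuous_apply i)
    have hC : C U = q ⁻¹' {y | Subgroup.closure (Set.range y) = ⊤} := by
      ext x
      simp only [C, q, Set.mem_setOf_eq, Set.mem_preimage]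
      have hmap : Subgroup.map (QuotientGroup.mk' U.1) (Subgroup.closure (Set.range x)) =
          Subgroup.closure (Set.range fun i => (QuotientGroup.mk (x i) : Γ ⧸ U.1)) := by
        rw [MonoidHom.map_closure, ← Set.range_comp]
        rfl
      constructor
      · intro hx
        rw [← hmap]
        have h1 : Subgroup.map (QuotientGroup.mk' U.1) (Subgroup.closure (Set.range x) ⊔ U.1) = ⊤ := by
          rw [hx, Subgroup.map_top_of_surjective _ (QuotientGroup.mk'_surjective U.1)]
        have hU0 : Subgroup.map (QuotientGroup.mk' U.1) U.1 = ⊥ :=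
          (Subgroup.map_eq_bot_iff _).mpr (by rw [QuotientGroup.ker_mk'])
        rwa [Subgroup.map_sup, hU0, sup_bot_eq] at h1
      · intro hx
        have := Subgroup.comap_map_eq (QuotientGroup.mk' U.1) (Subgroup.closure (Set.range x))
        rw [hmap, hx, Subgroup.comap_top, QuotientGroup.ker_mk'] at this
        exact this.symm
    rw [hC]
    exact (isClosed_discrete _).preimage hq
  have hne : ∀ U : S, (C U).Nonempty := fun U => h U.1 U.2.1 U.2.2
  have hdir : Directed (· ⊇ ·) C := by
    intro U V
    haveI : U.1.Normal := U.2.1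
    haveI : V.1.Normal := V.2.1
    refine ⟨⟨U.1 ⊓ V.1, inferInstance, U.2.2.inter V.2.2⟩, ?_, ?_⟩
    · intro x hx
      exact top_le_iff.mp (hx.symm.le.trans (sup_le_sup_left inf_le_left _))
    · intro x hx
      exact top_le_iff.mp (hx.symm.le.trans (sup_le_sup_left inf_le_right _))
  obtain ⟨x, hx⟩ := IsCompact.nonempty_iInter_of_directed_nonempty_isCompact_isClosed C hdir hne
    (fun U => (hclosed U).isCompact) hclosed
  -- `x` generates a dense subgroup
  refine ⟨⟨Finset.univ.image x, ?_⟩⟩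
  rw [Finset.coe_image, Finset.coe_univ, Set.image_univ]
  set H := Subgroup.closure (Set.range x)
  have hHU : ∀ U : S, H ⊔ U.1 = ⊤ := fun U => Set.mem_iInter.mp hx U
  rw [eq_top_iff]
  intro γ _
  rw [← SetLike.mem_coe, Subgroup.topologicalClosure_coe, mem_closure_iff]
  intro W hW hγW
  -- an open normal subgroup `U` with `γ U ⊆ W`
  have h1 : IsOpen ((fun u => γ * u) ⁻¹' W) := hW.preimage (continuous_const_mul γ)
  obtain ⟨U, hU⟩ := ProfiniteGrp.exist_openNormalSubgroup_sub_open_nhds_of_one h1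
    (show γ * 1 ∈ W by rwa [mul_one])
  have hγ : γ ∈ ((H ⊔ (U : Subgroup Γ) : Subgroup Γ) : Set Γ) := by
    rw [hHU ⟨U, inferInstance, U.isOpen⟩]
    exact Subgroup.mem_top γ
  rw [Subgroup.mul_normal] at hγ
  obtain ⟨a, ha, u, hu, hau⟩ := Set.mem_mul.mp hγ
  refine ⟨a, ?_, ha⟩
  -- `a = γ u⁻¹ ∈ γ U ⊆ W`
  have : a = γ * u⁻¹ := by rw [← hau, mul_inv_cancel_right]
  rw [this]
  exact hU (U.inv_mem hu)

end Profinite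

/-! ### The absolute Galois group of a `p`-adic field -/

section Local

open ValuativeRel IsNonarchimedeanLocalField

variable (F : Type) [Field F] [ValuativeRel F] [TopologicalSpace F] [IsNonarchimedeanLocalField F]
  [CharZero F]

omit [CharZero F] in
/-- **Every continuous finite quotient of `Γ_F` is solvable** (abstract-quotient form of the
tree's `isSolvable_quotient_of_isOpen`: `G ≅ Γ_F ⧸ ker π` with `ker π` open).
[cite: SerreLocalFields1979, Ch. IV §2 Cor. 5 of Prop. 7] -/
theorem isSolvable_of_surjective_absoluteGaloisGroup (G : Type) [Group G] [TopologicalSpace G]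
    [DiscreteTopology G] (π : absoluteGaloisGroup F →ₜ* G) (hπ : Surjective π) : IsSolvable G := by
  have hker : IsOpen (((π : absoluteGaloisGroup F →* G).ker : Set (absoluteGaloisGroup F))) := by
    change IsOpen (π ⁻¹' {1})
    exact (isOpen_discrete _).preimage (map_continuous π)
  haveI := isSolvable_quotient_of_isOpen F (π : absoluteGaloisGroup F →* G).ker hker
  exact solvable_of_surjective
    (QuotientGroup.quotientKerEquivOfSurjective (π : absoluteGaloisGroup F →* G) hπ).surjective

/-- **Every continuous finite quotient of `Γ_F` is generated by `c_F + 4` elements**, where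
`c_F = #(𝒪_F / p 𝒪_F)`, GIVEN Tate's local Euler–Poincaré characteristic for `F` (`hEP`):
Gaschütz lifting along a chief series (tree `exists_fin_generators_of_natCard_hOne_le`) with the
solvability of the finite quotients and the uniform bound `#H¹(F, M) ≤ |M|^{c_F+2}`
(tree `natCard_continuousCohomology_one_le_pow`).
[cite: NeukirchSchmidtWingberg2008, Thm. 7.5.10] [cite: Gaschutz1955, Satz 1] -/
theorem exists_fin_generators_of_surjective_absoluteGaloisGroup (hEP : localEulerPoincareCharacteristic F)
    (G : Type) [Group G] [TopologicalSpace G] [DiscreteTopology G] [Finite G]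
    (π : absoluteGaloisGroup F →ₜ* G) (hπ : Surjective π) :
    ∃ x : Fin (Nat.card (𝒪[F] ⧸ Ideal.span {((ringChar 𝓀[F] : ℕ) : 𝒪[F])}) + 2 + 2) → G,
      Subgroup.closure (Set.range x) = ⊤ :=
  exists_fin_generators_of_natCard_hOne_le
    (fun _ _ _ _ _ ρ _ hℓ hM => natCard_continuousCohomology_one_le_pow F hEP ρ hℓ hM)
    (fun G _ _ _ _ π hπ => isSolvable_of_surjective_absoluteGaloisGroup F G π hπ) G π hπ

/-- **`Γ_F` is topologically finitely generated** for a non-archimedean local field `F` of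
characteristic `0`, GIVEN Tate's local Euler–Poincaré characteristic for `F` (the tree's named fact
`localEulerPoincareCharacteristic F`, proved Summits-side as `localEulerPoincareCharacteristic_holds`):
every finite discrete quotient `Γ_F ⧸ U` is `(c_F + 4)`-generated
(`exists_fin_generators_of_surjective_absoluteGaloisGroup`), and compactness
(`isTopologicallyFinitelyGenerated_of_forall_quotient`).
[cite: NeukirchSchmidtWingberg2008, Thm. 7.5.10] [cite: MochizukiAbsTopI2012, Thm 2.6 (ii) proof p.23] -/
theorem isTopologicallyFinitelyGenerated_absoluteGaloisGroup_of_localEPC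
    (hEP : localEulerPoincareCharacteristic F) :
    IsTopologicallyFinitelyGenerated (absoluteGaloisGroup F) := by
  refine isTopologicallyFinitelyGenerated_of_forall_quotient
    (D := Nat.card (𝒪[F] ⧸ Ideal.span {((ringChar 𝓀[F] : ℕ) : 𝒪[F])}) + 2 + 2) fun U hU hUo => ?_
  haveI := hU
  letI : TopologicalSpace (absoluteGaloisGroup F ⧸ U) := ⊥
  haveI : DiscreteTopology (absoluteGaloisGroup F ⧸ U) := ⟨rfl⟩
  haveI : Finite (absoluteGaloisGroup F ⧸ U) := finite_quotient_of_isOpen F U hUo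
  -- the quotient map is continuous for the discrete topology since `U` is open
  have hcont : Continuous (QuotientGroup.mk' U : absoluteGaloisGroup F → absoluteGaloisGroup F ⧸ U) := by
    refine continuous_discrete_rng.mpr fun y => ?_
    obtain ⟨g, rfl⟩ := QuotientGroup.mk_surjective y
    have : (QuotientGroup.mk' U) ⁻¹' {(QuotientGroup.mk g : absoluteGaloisGroup F ⧸ U)} =
        (fun u => g * u) '' (U : Set (absoluteGaloisGroup F)) := by
      ext σ
      simp only [Set.mem_preimage, Set.mem_singleton_iff, QuotientGroup.mk'_apply, Set.mem_image,
        SetLike.mem_coe]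
      rw [QuotientGroup.eq]
      constructor
      · intro hσ
        refine ⟨g⁻¹ * σ, ?_, by rw [mul_inv_cancel_left]⟩
        have := U.inv_mem hσ
        simpa using this
      · rintro ⟨u, hu, rfl⟩
        have := U.inv_mem hu
        simpa using this
    rw [this]
    exact (Homeomorph.mulLeft g).isOpenMap _ hUo
  let π : absoluteGaloisGroup F →ₜ* absoluteGaloisGroup F ⧸ U := ⟨QuotientGroup.mk' U, hcont⟩
  obtain ⟨y, hy⟩ := exists_fin_generators_of_surjective_absoluteGaloisGroup F hEP _ π
    (QuotientGroup.mk'_surjective U)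
  choose x hx using fun i => QuotientGroup.mk_surjective (y i)
  refine ⟨x, ?_⟩
  have hmap : Subgroup.map (QuotientGroup.mk' U) (Subgroup.closure (Set.range x)) = ⊤ := by
    rw [MonoidHom.map_closure, ← Set.range_comp]
    have : (QuotientGroup.mk' U) ∘ x = y := funext fun i => hx i
    rw [this, hy]
  have := Subgroup.comap_map_eq (QuotientGroup.mk' U) (Subgroup.closure (Set.range x))
  rw [hmap, Subgroup.comap_top, QuotientGroup.ker_mk'] at this
  exact this.symm

end Local

/-! ### The `ℚ_p`-binder form -/

/-- **[NSW] Thm 7.5.10 (finite-generation clause) / [AbsTopI] Thm 2.6 (ii) input, `ℚ_p`-binder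
form, GIVEN Tate's local Euler–Poincaré characteristic** for non-archimedean local fields of
characteristic `0` (the tree's named fact, quantified over `F : Type`; it is PROVED Summits-side —
`localEulerPoincareCharacteristic_holds` — where the unconditional corollary is filed): for every
prime `p` and every finite extension `K/ℚ_p`, `Gal(K̄/K)` is topologically finitely generated.
The binder `K` is given the tree's valued model (`FiniteExtension.valuativeRel/topologicalSpace/
isNonarchimedeanLocalField` over `Padic.isNonarchimedeanLocalField_holds`).
[cite: NeukirchSchmidtWingberg2008, Thm. 7.5.10] [cite: MochizukiAbsTopI2012, Thm 2.6 (ii) proof p.23] -/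
theorem isTopologicallyFinitelyGenerated_absoluteGaloisGroup_padic_of_localEPC
    (hEP : ∀ (F : Type) [Field F] [ValuativeRel F] [TopologicalSpace F] [IsNonarchimedeanLocalField F]
      [CharZero F], localEulerPoincareCharacteristic F)
    (p : ℕ) [Fact p.Prime] (K : Type) [Field K] [Algebra ℚ_[p] K] [FiniteDimensional ℚ_[p] K] :
    IsTopologicallyFinitelyGenerated (absoluteGaloisGroup K) := by
  haveI : IsNonarchimedeanLocalField ℚ_[p] := Padic.isNonarchimedeanLocalField_holds p
  letI := FiniteExtension.valuativeRel ℚ_[p] K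
  letI := FiniteExtension.topologicalSpace ℚ_[p] K
  haveI : IsNonarchimedeanLocalField K := FiniteExtension.isNonarchimedeanLocalField ℚ_[p] K
  haveI : CharZero K := charZero_of_injective_algebraMap (algebraMap ℚ_[p] K).injective
  exact isTopologicallyFinitelyGenerated_absoluteGaloisGroup_of_localEPC K (hEP K)

end Literature.AnabelianGeometry.AbsoluteAnabelian

end
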